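import Literature.NumberTheory.Sieve.PolymathBoundedGapsM50OrbitalMain
import Literature.NumberTheory.Sieve.PrimeGapsProdRadial
import HarnessLib

/-!
# `liminf (p_{n+1} − p_n) ≤ 246` with standard axioms (Polymath 8b, Theorem 1.4(i)) from the kernel-checked `M_{50,1/27} > 4`

The tree's `frequently_nth_prime_succ_le_add_polymath_holds` proves `H₁ ≤ 246` through Theorem 3.13(i) with a `native_decide`
leaf (`Lean.ofReduceBool`); the kernel-pure frontier was `252` (`frequently_nth_prime_succ_le_add_252`, `PrimeGapsProdRadial`, from the
product-radial certificate `M_{51,1/25} > 4`).  This file derives `246` from the KERNEL-checked labelled product-radial certificate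
`PolymathCert.PolymathM50Orbital.exists_polymathFunctional_50_gt_four` (`PolymathBoundedGapsM50Orbital*`: parity-ideate ROUND-24
certificate E1 T_3, `ε = 1/27`, base profile + three orbitals, `λ = 4.000110928047049…`) by the same deduction as `252`/`254`:
`weakDHL_two_of_exists_polymathFunctional_gt_four` (Bombieri–Vinogradov via Siegel–Walfisz, Theorem 3.12(i) ⇒ `DHL[50,2]`) and
`frequently_nth_prime_succ_le_add_polymath_of_weakDHL` (the admissible 50-tuple of diameter 246).  Axioms: `propext`,
`Classical.choice`, `Quot.sound`.

## References
* D. H. J. Polymath, Res. Math. Sci. 1 (2014), Art. 12 = arXiv:1407.4897, Theorem 1.4(i) and its deduction (pp. 8, 11),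
  Theorems 3.12(i), 3.13. [Polymath8b2014]
-/

namespace Literature.NumberTheory.Sieve

/-- **`liminf (p_{n+1} − p_n) ≤ 246`, kernel-pure**: `p_{n+1} ≤ p_n + 246` for infinitely many `n` (Polymath 8b Theorem 1.4(i)
at `k = 50` with the labelled product-radial certificate `M_{50,1/27} > 4`; no `Lean.ofReduceBool`).
[cite: Polymath8b2014, Theorem 1.4(i) (deduction, pp. 8 and 11), k = 50] -/
theorem frequently_nth_prime_succ_le_add_246 :
    ∃ᶠ n in Filter.atTop, Nat.nth Nat.Prime (n + 1) ≤ Nat.nth Nat.Prime n + 246 :=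
  frequently_nth_prime_succ_le_add_polymath_of_weakDHL
    (weakDHL_two_of_exists_polymathFunctional_gt_four 50 (by norm_num)
      PolymathCert.PolymathM50Orbital.exists_polymathFunctional_50_gt_four)

/-- The tree's named statement `frequently_nth_prime_succ_le_add_polymath` (`H₁ ≤ 246`), now with standard axioms.
[cite: Polymath8b2014, Theorem 1.4(i)] -/
theorem frequently_nth_prime_succ_le_add_polymath_kernel : frequently_nth_prime_succ_le_add_polymath :=
  frequently_nth_prime_succ_le_add_246

end Literature.NumberTheory.Sieve
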